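import Mathlib
import Literature.NumberTheory.Sieve.BatemanHorn

/-!
# Sketch (crux-ideate stmt-Parity-9769 = SelbergDelangeRigidity.NormalFamilyBound, ideator 2, round 1)

First lemmas / transfer statements for the two idea cards
* `renewal-phase-bootstrap`  (exact renewal identity for `z S_x'(z)`, one-sided Grönwall in the angle,
  phase-velocity transfer);
* `tilt-recentred-expansion` (Möbius expansion of `z^Ω` around a positive tilt `y`, small coefficients
  `|z/y-1|^{ω(d)}`, fixed-`δ` discrepancy transfer).
Everything is a `def … : Prop` over Mathlib + `Literature.NumberTheory.Sieve` (no sorries); nothing here is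
claimed proved.  `Ω = ArithmeticFunction.cardFactors`, `ω = ArithmeticFunction.cardDistinctFactors`.
-/

noncomputable section

open Finset Complex Polynomial
open scoped BigOperators

namespace Summit.Parity.BatemanHorn.Cruxes.NormalFamilyBound.Ideator2R1

variable {k : ℕ}

/-- `Ω_f(n) = ∑ᵢ Ω(fᵢ(n))` exactly as in the crux (`toNat`, `cardFactors 0 = 0`). -/
def OmegaF (f : Fin k → ℤ[X]) (n : ℕ) : ℕ :=
  ∑ i, ArithmeticFunction.cardFactors (((f i).eval (n : ℤ)).toNat)

/-- `S_x(z) = ∑_{0 ≤ n ≤ x} z^{Ω_f(n)}` (the crux's polynomial; `H_x(z) = x⁻¹ (log x)^{k(1-z)} S_x(z)`). -/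
def S (f : Fin k → ℤ[X]) (x : ℕ) (z : ℂ) : ℂ :=
  ∑ n ∈ range (x + 1), z ^ OmegaF f n

/-- `z S_x'(z) = ∑_n Ω_f(n) z^{Ω_f(n)}` (the complex-tilted first moment, un-normalised). -/
def SMom (f : Fin k → ℤ[X]) (x : ℕ) (z : ℂ) : ℂ :=
  ∑ n ∈ range (x + 1), (OmegaF f n : ℂ) * z ^ OmegaF f n

/-- The crux's normalised family `H_x(z)` for the system `f`. -/
def H (f : Fin k → ℤ[X]) (x : ℕ) (z : ℂ) : ℂ :=
  (x : ℂ)⁻¹ * Complex.exp ((k : ℂ) * (1 - z) * (Real.log (Real.log x) : ℂ)) * S f x z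

/-- A crude bound for all values `fᵢ(n)`, `n ≤ x` (so every prime power dividing a positive value is
`≤ valBound`). -/
def valBound (f : Fin k → ℤ[X]) (x : ℕ) : ℕ :=
  1 + ∑ n ∈ range (x + 1), ∑ i, ((f i).eval (n : ℤ)).toNat

/-- Root-class (prime-power-class) restricted sum: `∑_{n ≤ x, q ∣ fᵢ(n) > 0} z^{Ω_f(n)}` — for `q = p^v`
a union of `≤ deg fᵢ`-many (Hensel) progressions mod `p^v`, i.e. the same statistic for the systems
`n ↦ f(a + p^v m)`. -/
def Aclass (f : Fin k → ℤ[X]) (x q : ℕ) (i : Fin k) (z : ℂ) : ℂ :=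
  ∑ n ∈ (range (x + 1)).filter (fun n : ℕ => 0 < (f i).eval (n : ℤ) ∧ q ∣ ((f i).eval (n : ℤ)).toNat),
    z ^ OmegaF f n

/-! ## Card `renewal-phase-bootstrap` -/

/-- ENGINE (pointwise, Mathlib-provable): `Ω(m)` is the number of prime powers `q ≥ 2` dividing `m`. -/
def CardFactorsEqPrimePowCount : Prop :=
  ∀ m : ℕ, 0 < m →
    ArithmeticFunction.cardFactors m = ((Icc 1 m).filter (fun q => IsPrimePow q ∧ q ∣ m)).card

/-- FIRST LEMMA (L1a, exact renewal identity): by complete additivity of `Ω` over prime powers,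
`z S_x'(z) = ∑ᵢ ∑_{q = p^v} A^{(i)}_{x,q}(z)` — the complex-tilted first moment is an additive sum over
prime powers of root-class restrictions of the SAME statistic (self-similar family recursion). Stated
for systems all of whose values on `[0, x]` are positive (true for `n ≥ n₀(f)`; the finitely many small
`n` are an `O_f(1)` bookkeeping term). -/
def RenewalIdentity : Prop :=
  ∀ (k : ℕ) (f : Fin k → ℤ[X]) (x : ℕ) (z : ℂ),
    (∀ i, ∀ n ∈ range (x + 1), 0 < (f i).eval (n : ℤ)) →
      SMom f x z = ∑ i, ∑ q ∈ (Icc 1 (valBound f x)).filter IsPrimePow, Aclass f x q i z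

/-- FIRST LEMMA (L1b, phase identity): on a zero-free point of the circle `|z| = r`,
`d/dθ log ‖P(r e^{iθ})‖ = -Im (z P'(z)/P(z))`, `z = r e^{iθ}` — for `P = S_x` the right side is
`-Im E_z[Ω_f]`, the (complex-tilted) mean of `Ω_f`. Pure Mathlib calculus. -/
def PhaseDerivative : Prop :=
  ∀ (P : ℂ[X]) (r θ : ℝ), 0 < r →
    P.eval ((r : ℂ) * Complex.exp ((θ : ℂ) * Complex.I)) ≠ 0 →
      HasDerivAt (fun t : ℝ => Real.log ‖P.eval ((r : ℂ) * Complex.exp ((t : ℂ) * Complex.I))‖)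
        (-(((r : ℂ) * Complex.exp ((θ : ℂ) * Complex.I) *
              (derivative P).eval ((r : ℂ) * Complex.exp ((θ : ℂ) * Complex.I)) /
              P.eval ((r : ℂ) * Complex.exp ((θ : ℂ) * Complex.I))).im)) θ

/-- FIRST LEMMA (L1c, one-sided Grönwall / continuity method in the angle): if `g(0) ≤ 0` and the slope
bound `g' ≤ C` is known ONLY where `g ≥ Cθ - K` (i.e. only where `|S_x(z)|` is within `e^{-K}` of the
target), then `g(θ) ≤ Cθ` on the whole interval. (Proof: sup argument + MVT; M-sized Mathlib exercise.) -/
def OneSidedGronwall : Prop :=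
  ∀ (g : ℝ → ℝ) (C K θ₁ : ℝ), 0 ≤ K → 0 < θ₁ →
    ContinuousOn g (Set.Icc 0 θ₁) → DifferentiableOn ℝ g (Set.Ioo 0 θ₁) → g 0 ≤ 0 →
      (∀ θ ∈ Set.Ioo 0 θ₁, C * θ - K ≤ g θ → deriv g θ ≤ C) →
        ∀ θ ∈ Set.Icc 0 θ₁, g θ ≤ C * θ

/-- Real-axis order of magnitude, uniform on compact tilt ranges (Nair–Tenenbaum 1998 / Henriot 2012 type;
positive weights, KNOWN in print, `--supports` material): `S_x(r) ≤ C x (log x)^{k(r-1)}`. -/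
def RealAxisOrderUniform (k : ℕ) (f : Fin k → ℤ[X]) : Prop :=
  ∀ r₁ r₂ : ℝ, 0 < r₁ → r₁ ≤ r₂ → r₂ < 2 →
    ∃ C : ℝ, ∀ x : ℕ, 3 ≤ x → ∀ r : ℝ, r₁ ≤ r → r ≤ r₂ →
      ‖S f x (r : ℂ)‖ ≤ C * x * Real.log x ^ ((k : ℝ) * (r - 1))

/-- TRANSFER TARGET `C⁺` of card `renewal-phase-bootstrap` (phase-velocity lower bound): along every arc
`θ ↦ r e^{iθ}` from the positive axis that stays in the thin region, WHEREVER `|S_x(z)|` is still within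
`e^{-K}` of the model size `S_x(r) (log x)^{-k r (1 - cos θ)}`, the imaginary part of the complex-tilted mean
`E_z[Ω_f] = z S'/S` in the direction of travel is at least its model value `k r |sin θ| log log x` minus a
constant. One-sided, first-moment, additive over prime powers via `RenewalIdentity`. -/
def PhaseVelocityLB (k : ℕ) (f : Fin k → ℤ[X]) (η C K : ℝ) : Prop :=
  ∀ x : ℕ, 3 ≤ x → ∀ r θ : ℝ, 0 < r → r < 2 → |θ| < Real.pi →
    -η < r * Real.cos θ → r * Real.cos θ < 7 / 4 → |r * Real.sin θ| < η →
      Real.exp (-K) * Real.log x ^ (-((k : ℝ) * r * (1 - Real.cos θ))) * ‖S f x (r : ℂ)‖ ≤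
          ‖S f x ((r : ℂ) * Complex.exp ((θ : ℂ) * Complex.I))‖ →
        (k : ℝ) * r * |Real.sin θ| * Real.log (Real.log x) - C ≤
          Real.sign θ *
            (SMom f x ((r : ℂ) * Complex.exp ((θ : ℂ) * Complex.I)) /
                S f x ((r : ℂ) * Complex.exp ((θ : ℂ) * Complex.I))).im

/-- TRANSFER LEMMA (claimed provable-now from `PhaseDerivative` + `OneSidedGronwall` + covering
`V_η` by arcs `|z| = r` from real base points): phase-velocity lower bound + real-axis order ⟹ the crux's
local boundedness for this `f` (indeed a uniform bound on all of `V_η`, `x ≥ 3`; the finitely many `x < 3`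
and each point's ball are trivial since every `H_x` is entire). -/
def BootstrapTransfer : Prop :=
  ∀ (k : ℕ) (f : Fin k → ℤ[X]) (η : ℝ), 0 < η → η ≤ 1 / 4 →
    Literature.NumberTheory.Sieve.IsBatemanHornSystem f →
    (∃ C K : ℝ, 0 ≤ K ∧ PhaseVelocityLB k f η C K) → RealAxisOrderUniform k f →
      ∃ M : ℝ, ∀ x : ℕ, 3 ≤ x →
        ∀ z ∈ {z : ℂ | -η < z.re ∧ z.re < 7 / 4 ∧ |z.im| < η}, ‖H f x z‖ ≤ M

/-- PARITY INPUT of the negative-axis anchoring (card `renewal-phase-bootstrap`, Transfer 2): the REAL alternating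
almost-prime sums `S_x(-t) = ∑_j π_j(x) (-t)^j = ∑_n λ(F(n)) t^{Ω_f(n)}` have the Landau–Selberg–Delange order
`x (log x)^{-k(1+t)}` for `0 < t < η₀` — "damped Chowla along `F` to Poisson order"; this one-parameter family of REAL
statements is where the card confines the parity content of the whole near-zero box. -/
def RealSegmentParity (k : ℕ) (f : Fin k → ℤ[X]) (η₀ C : ℝ) : Prop :=
  ∀ x : ℕ, 3 ≤ x → ∀ t : ℝ, 0 < t → t < η₀ →
    ‖S f x (-(t : ℂ))‖ ≤ C * x * Real.log x ^ (-((k : ℝ) * (1 + t)))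

/-- GHOST-INSENSITIVE companion (Transfer 2): along the arcs `φ ↦ t e^{iφ}` running from the NEGATIVE real point
(`φ = π`) towards `φ = ±π/2`, `|S_x|` may grow at most at the model rate: an UPPER bound
`sign(φ) · Im E_z[Ω_f] ≤ k t |sin φ| log log x + C`, again only where `|S_x(z)|` is within `e^{-K}` of the target.
The parity ghost `S + δ S(-·)` satisfies it (its tilted mean has the opposite sign), so Selberg's example does not
exclude a parity-free proof of this conjunct. -/
def PhaseVelocityUB (k : ℕ) (f : Fin k → ℤ[X]) (η C K : ℝ) : Prop :=
  ∀ x : ℕ, 3 ≤ x → ∀ t φ : ℝ, 0 < t → t < 2 * η → Real.pi / 2 ≤ |φ| → |φ| ≤ Real.pi → |t * Real.sin φ| < η →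
    Real.exp (-K) * Real.log x ^ ((k : ℝ) * (t * Real.cos φ - 1)) * x ≤
        ‖S f x ((t : ℂ) * Complex.exp ((φ : ℂ) * Complex.I))‖ →
      Real.sign φ *
          (SMom f x ((t : ℂ) * Complex.exp ((φ : ℂ) * Complex.I)) /
              S f x ((t : ℂ) * Complex.exp ((φ : ℂ) * Complex.I))).im ≤
        (k : ℝ) * t * |Real.sin φ| * Real.log (Real.log x) + C

/-- TRANSFER 2 (near-zero box, claimed provable-now by the same `PhaseDerivative` + `OneSidedGronwall`, mirrored):
real-segment parity for `t < 2η` + the ghost-insensitive growth bound ⟹ the crux's bound on the closed left box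
`{-η < Re z ≤ 0, |Im z| < η}` (every such `z ≠ 0` is `t e^{iφ}` with `t < η√2 < 2η`, `|φ| ≥ π/2`; `z = 0` is trivial).
Together with `BootstrapTransfer` (right part) this covers all of `V_η`, with parity confined to `RealSegmentParity`. -/
def NegativeAnchorTransfer : Prop :=
  ∀ (k : ℕ) (f : Fin k → ℤ[X]) (η : ℝ), 0 < η → η ≤ 1 / 4 →
    Literature.NumberTheory.Sieve.IsBatemanHornSystem f →
    (∃ C : ℝ, RealSegmentParity k f (2 * η) C) → (∃ C K : ℝ, 0 ≤ K ∧ PhaseVelocityUB k f η C K) →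
      ∃ M : ℝ, ∀ x : ℕ, 3 ≤ x →
        ∀ z ∈ {z : ℂ | -η < z.re ∧ z.re ≤ 0 ∧ |z.im| < η}, ‖H f x z‖ ≤ M

/-! ## Card `tilt-recentred-expansion` -/

/-- Coefficient of the Möbius expansion of the completely multiplicative `n ↦ w^{Ω(n)}`:
`g_w(d) = (w-1)^{ω(d)} w^{Ω(d)-ω(d)}` (so `|g_w(p)| = |w - 1|`, small when `w = z/y ≈ 1`). -/
def gcoef (w : ℂ) (d : ℕ) : ℂ :=
  (w - 1) ^ ArithmeticFunction.cardDistinctFactors d *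
    w ^ (ArithmeticFunction.cardFactors d - ArithmeticFunction.cardDistinctFactors d)

/-- FIRST LEMMA (L2a, pointwise engine, Mathlib-provable by multiplicativity):
`w^{Ω(m)} = ∑_{d ∣ m} (w-1)^{ω(d)} w^{Ω(d)-ω(d)}` for `m ≠ 0`. With `w = z/y` this rewrites `z^{Ω}` as the
POSITIVE tilt `y^{Ω}` times a divisor sum with coefficients of size `|z/y - 1|^{ω(d)} ≤ η^{ω(d)}`. -/
def TiltExpansionPointwise : Prop :=
  ∀ m : ℕ, m ≠ 0 → ∀ w : ℂ,
    w ^ ArithmeticFunction.cardFactors m = ∑ d ∈ m.divisors, gcoef w d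

/-- Positive-weight (`y`-tilted) root-class sums `A^{(y)}_d(x) = ∑_{n ≤ x, F(n) > 0, d ∣ F(n)} y^{Ω_f(n)}`,
`F = ∏ fᵢ`; `A_1 = S_x(y)` up to the finitely many `n` with `F(n) ≤ 0`. -/
def Atilt (f : Fin k → ℤ[X]) (x : ℕ) (y : ℝ) (d : ℕ) : ℝ :=
  ∑ n ∈ (range (x + 1)).filter
      (fun n : ℕ => 0 < ∏ i, (f i).eval (n : ℤ) ∧ d ∣ (∏ i, (f i).eval (n : ℤ)).toNat),
    y ^ OmegaF f n

/-- Majorant of `|g_{z/y}(d)|` on the ball `|z - y| < η` (so `|z/y - 1| < ε := η/y`):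
`ε^{ω(d)} (1+ε)^{Ω(d)-ω(d)}`. -/
def wgt (ε : ℝ) (d : ℕ) : ℝ :=
  ε ^ ArithmeticFunction.cardDistinctFactors d *
    (1 + ε) ^ (ArithmeticFunction.cardFactors d - ArithmeticFunction.cardDistinctFactors d)

/-- TRANSFER TARGET `C⁺` of card `tilt-recentred-expansion` at the real base point `y` (FIXED-`δ` tilted
discrepancy bound on the strip-covering ball `|z - y| < η`): for SOME model `m : ℕ → ℝ` of the relative densities
`A_d/A_1` (any function — in practice the tilted local densities times the Dickman room correction
`φ_y(log d / log x)` seen in the numerics), (i) the model main term `∑_d g_{z/y}(d) m(d)` has the model size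
`(log x)^{k(Re z - y)}` on the ball, and (ii) the `wgt (η/y)`-weighted ABSOLUTE discrepancy
`∑_d wgt(d) |A_d - m(d) A_1|` saves a FIXED power `(log x)^{-δ}` over its trivial size `≍ A_1 (log x)^{kη}`.
Part (ii) is the whole content: relative equidistribution of the POSITIVE tilted sequence `y^{Ω_f(n)}` in root
classes at ALL modulus scales `d ≤ C x^D` (beyond the level `x`), but only with a log-power `δ` independent of `η`. -/
def TiltedDiscrepancy (k : ℕ) (f : Fin k → ℤ[X]) (y η δ : ℝ) : Prop :=
  ∃ m : ℕ → ℝ, ∃ C : ℝ, ∃ x₀ : ℕ, ∀ x : ℕ, x₀ ≤ x →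
    (∀ z : ℂ, ‖z - y‖ < η →
        ‖∑ d ∈ Icc 1 (valBound f x), gcoef (z / y) d * m d‖ ≤ C * Real.log x ^ ((k : ℝ) * (z.re - y))) ∧
    (∑ d ∈ Icc 1 (valBound f x), wgt (η / y) d * |Atilt f x y d - m d * Atilt f x y 1| ≤
        C * Atilt f x y 1 * Real.log x ^ ((k : ℝ) * η - δ))

/-- TRANSFER LEMMA (claimed provable-now: `TiltExpansionPointwise`, triangle inequality, `|g_{z/y}(d)| ≤ wgt (η/y) d`
on the ball, `RealAxisOrderUniform`): a fixed-`δ` tilted discrepancy bound at base `y` with `δ ≥ 2 k η` gives the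
crux's bound on the ball `|z - y| < η` for all large `x` (small `x`: each `H_x` is entire, hence bounded there).
Balls around `y ∈ [y₁, 7/4)` cover `V_η ∩ {Re z ≥ y₁}`; the disc around `0` (parity part) is NOT addressed. -/
def TiltTransfer : Prop :=
  ∀ (k : ℕ) (f : Fin k → ℤ[X]) (y η δ : ℝ),
    Literature.NumberTheory.Sieve.IsBatemanHornSystem f →
    0 < y → y < 7 / 4 → 0 < η → η ≤ 1 / 4 → 2 * (k : ℝ) * η ≤ δ →
    TiltedDiscrepancy k f y η δ → RealAxisOrderUniform k f →
      ∃ M : ℝ, ∃ x₀ : ℕ, ∀ x : ℕ, x₀ ≤ x → ∀ z : ℂ, ‖z - y‖ < η → ‖H f x z‖ ≤ M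

end Summit.Parity.BatemanHorn.Cruxes.NormalFamilyBound.Ideator2R1
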